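import Summits.RiemannHypothesis.RiemannHypothesis.Theorems.Splittings.NbLevelCertificate
import Mathlib.NumberTheory.LSeries.Convolution
import Mathlib.NumberTheory.ArithmeticFunction.Moebius
import Mathlib.NumberTheory.ArithmeticFunction.Misc
import Mathlib.Analysis.SpecialFunctions.ImproperIntegrals
import HarnessLib

/-!
# RH-EQUIVALENT·SPLITTING CENSUS (nb, neg) · V37 «PLATEAU / BUDGET-FREE MÖBIUS LOCK» (file 1 of 3: plateaus, integral bounds, Möbius inversion with weighted errors): the Báez-Duarte approximant `χ − Σ_{j<N} c_j ρ_{j+1}` is step-like, its plateau values are `O(m·d_N)` and its plateau jumps are the divisor sums of the coefficient sequence; nothing here bears on the truth of RH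

LABEL (line 1): RH-EQUIVALENT·SPLITTING (cell `rh-split`, seat (nb, neg), generation 12, census
candidate V37, file 1 of 3).  Zero definitions; standard axioms; imports the LANDED dictionary file
`Splittings.NbLevelCertificate` (for `bdDil`, `integral_norm_sq_nbFun_eq_nbDistSq`) + Mathlib
leaves + HarnessLib.  Files 2/3: `Splittings.NbPlateauLockReal` (THE LOCK on the `L²` side, the
zero-free length law, the ζ side for real vectors, symmetrisation), `Splittings.NbPlateauLockComplex`
(the lock for arbitrary complex coefficient vectors of the route functional; census consequences).

## The mechanism (an effective Báez-Duarte Lemma 4.2, arXiv:math/0011254 §4, in `L²` instead of pointwise)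

For REAL coefficients `c : Fin N → ℝ` the approximant `f = χ_{(0,1]} − Σ_j c_j {1/((j+1)t)}`
(`BaezDuarteU.nbFun (bdDil N) c`, whose `∫_0^∞ |f|²` is `nbDistSq N c = d_N²(c)` by the landed
dictionary) is a STEP-LIKE function: on the plateau `1/(m+1) < t < 1/m` (`m ≥ 1`) one has
`⌊1/((j+1)t)⌋ = ⌊m/(j+1)⌋`, hence

  `f(t) = P_m − T/t`,  `P_m := 1 + Σ_j c_j ⌊m/(j+1)⌋`,  `T := Σ_j c_j/(j+1)`   (`nbFun_plateau`),

and `f(t) = −T/t` for `t > 1` (`nbFun_Ioi_one`).  Consequently `T² = ∫_1^∞ |f|² ≤ d²`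
(`sq_tailCoeff_le_nbDistSq`) and, from `(P − T/t)² ≥ P²/2 − T²(m+1)²` on a plateau of length
`1/(m(m+1))`, `|P_m| ≤ 2(m+1)·d` (`abs_plateau_le`).  The plateau JUMPS are divisor sums:
`P_{m+1} − P_m = Σ_{(j+1) ∣ (m+1)} c_j = (ζ * Φ)(m+1)` for the arithmetic function `Φ(j+1) = c_j`
(`plateau_succ_sub`, `coe_zeta_mul_coeffFn`), so `|(ζ * Φ)(e) + δ(e)| ≤ (4e+2)·d` for every `e ≥ 1`
(`abs_divisorSum_add_one_le`), and MÖBIUS INVERSION WITH WEIGHTED ERRORS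
(`abs_add_moebius_le_of_divisorSums`: `Φ + μ = μ * (ζ * Φ + δ)`, `|Φ(n) + μ(n)| ≤ 6 σ₁(n) d`)
gives the lock of file 2.

In print the lock is QUALITATIVE and lives in Beurling's step-function class from pointwise
convergence (Báez-Duarte 2000, Lemma 4.2 / Remark 4.7, arXiv:math/0011254; numerically
Landreau–Richard, Exp. Math. 11 (2002) p. 352); the effective `L²` form is this census's.

HONEST LABEL: «SPLITTING SEARCH over kernel-typed RH-EQUIVALENCES; a splitting A ∧ B ⟹ RH is
CONDITIONAL bookkeeping unless A and B are both proved; nothing here bears on the truth of RH.»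
-/

set_option linter.dupNamespace false

namespace Summit.RiemannHypothesis.RiemannHypothesis.Theorems.Splittings.NbPlateauLock

open MeasureTheory Set Finset
open scoped ArithmeticFunction.Moebius ArithmeticFunction.zeta ComplexConjugate
open Literature.NumberTheory.LFunctions
open Summit.RiemannHypothesis.RiemannHypothesis.Theorems.NbTheory (nbDistSq)
open Summit.RiemannHypothesis.RiemannHypothesis.Theorems.Splittings.NbLevelCertificate

/-! ## 1. Plateaus of the Báez-Duarte approximant -/

/-- On the plateau `1/(m+1) < t < 1/m` (`m ≥ 1`) the fractional part `{1/(kt)}` (`k ≥ 1`) equals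
`1/(kt) − ⌊m/k⌋`. -/
theorem fract_plateau {m k : ℕ} (hm : 1 ≤ m) (hk : 1 ≤ k) {t : ℝ}
    (ht : t ∈ Ioo (1 / ((m : ℝ) + 1)) (1 / (m : ℝ))) :
    Int.fract (1 / ((k : ℝ) * t)) = 1 / ((k : ℝ) * t) - ((m / k : ℕ) : ℝ) := by
  have hmpos : (0 : ℝ) < m := by exact_mod_cast hm
  have hkpos : (0 : ℝ) < k := by exact_mod_cast hk
  have ht0 : 0 < t := lt_trans (by positivity) ht.1
  have hkt : 0 < (k : ℝ) * t := mul_pos hkpos ht0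
  have htm : t * m < 1 := by
    have h := ht.2
    rwa [lt_div_iff₀ hmpos] at h
  have htm' : 1 < t * ((m : ℝ) + 1) := by
    have h := ht.1
    rwa [div_lt_iff₀ (by positivity)] at h
  set q : ℕ := m / k with hq
  have hqk : (q : ℝ) * k ≤ m := by exact_mod_cast Nat.div_mul_le_self m k
  have hmq : (m : ℝ) + 1 ≤ ((q : ℝ) + 1) * k := by
    have h1 := Nat.div_add_mod m k
    have h2 := Nat.mod_lt m (show 0 < k by omega)
    have h3 : m + 1 ≤ (q + 1) * k := by
      rw [hq]
      nlinarith [h1, h2]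
    exact_mod_cast h3
  have h1 : ((q : ℤ) : ℝ) ≤ 1 / ((k : ℝ) * t) := by
    rw [Int.cast_natCast, le_div_iff₀ hkt]
    have := mul_le_mul_of_nonneg_right hqk ht0.le
    nlinarith
  have h2 : 1 / ((k : ℝ) * t) < ((q : ℤ) : ℝ) + 1 := by
    rw [Int.cast_natCast, div_lt_iff₀ hkt]
    have := mul_le_mul_of_nonneg_left hmq ht0.le
    nlinarith
  have hfloor : ⌊1 / ((k : ℝ) * t)⌋ = (q : ℤ) := Int.floor_eq_iff.mpr ⟨h1, h2⟩
  rw [← Int.self_sub_floor, hfloor, Int.cast_natCast]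

/-- **Plateau identity.**  On `1/(m+1) < t < 1/m` (`m ≥ 1`):
`χ(t) − Σ_j c_j {1/((j+1)t)} = P_m − T/t` with `P_m = 1 + Σ_j c_j ⌊m/(j+1)⌋`, `T = Σ_j c_j/(j+1)`. -/
theorem nbFun_plateau (N : ℕ) (c : Fin N → ℝ) {m : ℕ} (hm : 1 ≤ m) {t : ℝ}
    (ht : t ∈ Ioo (1 / ((m : ℝ) + 1)) (1 / (m : ℝ))) :
    BaezDuarteU.nbFun (bdDil N) c t =
      (((1 + ∑ j : Fin N, c j * (((m / ((j : ℕ) + 1) : ℕ) : ℝ))) -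
        (∑ j : Fin N, c j / (((j : ℕ) : ℝ) + 1)) / t : ℝ) : ℂ) := by
  have hmpos : (0 : ℝ) < m := by exact_mod_cast hm
  have ht0 : 0 < t := lt_trans (by positivity) ht.1
  have ht1 : t ≤ 1 := ht.2.le.trans (by rw [div_le_one hmpos]; exact_mod_cast hm)
  have hmem : t ∈ Ioc (0 : ℝ) 1 := ⟨ht0, ht1⟩
  rw [BaezDuarteU.nbFun]
  congr 1
  rw [Set.indicator_of_mem hmem, Pi.one_apply]
  have hfr : ∀ j : Fin N, c j * Int.fract (1 / (bdDil N j * t)) =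
      c j / (((j : ℕ) : ℝ) + 1) / t - c j * (((m / ((j : ℕ) + 1) : ℕ) : ℝ)) := by
    intro j
    have h := fract_plateau hm (k := (j : ℕ) + 1) (by omega) ht
    push_cast at h
    rw [show bdDil N j = ((j : ℕ) : ℝ) + 1 from rfl, h, mul_sub, mul_one_div, div_div]
  have hsum : ∑ j : Fin N, c j * Int.fract (1 / (bdDil N j * t)) =
      (∑ j : Fin N, c j / (((j : ℕ) : ℝ) + 1)) / t -
        ∑ j : Fin N, c j * (((m / ((j : ℕ) + 1) : ℕ) : ℝ)) := by
    rw [Finset.sum_div, ← Finset.sum_sub_distrib]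
    exact Finset.sum_congr rfl fun j _ ↦ hfr j
  rw [hsum]
  ring

/-- **Tail identity.**  For `t > 1`: `χ(t) − Σ_j c_j {1/((j+1)t)} = −T/t`, `T = Σ_j c_j/(j+1)`. -/
theorem nbFun_Ioi_one (N : ℕ) (c : Fin N → ℝ) {t : ℝ} (ht : t ∈ Ioi (1 : ℝ)) :
    BaezDuarteU.nbFun (bdDil N) c t =
      ((-(∑ j : Fin N, c j / (((j : ℕ) : ℝ) + 1)) / t : ℝ) : ℂ) := by
  have ht1 : (1 : ℝ) < t := ht
  have ht0 : 0 < t := one_pos.trans ht1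
  rw [BaezDuarteU.nbFun]
  congr 1
  have hnot : t ∉ Ioc (0 : ℝ) 1 := fun h ↦ (not_le.mpr ht1) h.2
  rw [Set.indicator_of_notMem hnot]
  have hfr : ∀ j : Fin N, c j * Int.fract (1 / (bdDil N j * t)) =
      c j / (((j : ℕ) : ℝ) + 1) / t := by
    intro j
    have hj : (1 : ℝ) ≤ bdDil N j := one_le_bdDil N j
    have hpos : 0 < bdDil N j * t := mul_pos (one_pos.trans_le hj) ht0
    have hlt : 1 / (bdDil N j * t) < 1 := by
      rw [div_lt_one hpos]
      nlinarith
    rw [Int.fract_eq_self.mpr ⟨by positivity, hlt⟩,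
      show bdDil N j = ((j : ℕ) : ℝ) + 1 from rfl, mul_one_div, div_div]
  rw [Finset.sum_congr rfl fun j _ ↦ hfr j, ← Finset.sum_div]
  ring

/-! ## 2. Integral bounds: the tail coefficient and the plateau values are `O(d)` -/

/-- `0 ≤ d_N²(c)`. -/
theorem nbDistSq_nonneg' (N : ℕ) (c : Fin N → ℝ) : 0 ≤ nbDistSq N c := by
  rw [← integral_norm_sq_nbFun_eq_nbDistSq]
  exact setIntegral_nonneg measurableSet_Ioi fun t _ ↦ sq_nonneg _

/-- **The tail plateau** `t > 1`: `T² = ∫_1^∞ |f|² ≤ d_N²(c)`, `T = Σ_j c_j/(j+1)`. -/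
theorem sq_tailCoeff_le_nbDistSq (N : ℕ) (c : Fin N → ℝ) :
    (∑ j : Fin N, c j / (((j : ℕ) : ℝ) + 1)) ^ 2 ≤ nbDistSq N c := by
  set T := ∑ j : Fin N, c j / (((j : ℕ) : ℝ) + 1) with hT
  have hf : ∀ t ∈ Ioi (1 : ℝ), ‖BaezDuarteU.nbFun (bdDil N) c t‖ ^ 2 = T ^ 2 * t ^ (-2 : ℝ) := by
    intro t ht
    have ht0 : (0 : ℝ) < t := one_pos.trans ht
    rw [nbFun_Ioi_one N c ht, Complex.norm_real, Real.norm_eq_abs, sq_abs,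
      Real.rpow_neg ht0.le, Real.rpow_two, div_pow, neg_sq, div_eq_mul_inv]
  have hI : ∫ t in Ioi (1 : ℝ), ‖BaezDuarteU.nbFun (bdDil N) c t‖ ^ 2 = T ^ 2 := by
    rw [setIntegral_congr_fun measurableSet_Ioi hf, integral_const_mul,
      integral_Ioi_rpow_of_lt (by norm_num) one_pos]
    norm_num
  rw [← hI, ← integral_norm_sq_nbFun_eq_nbDistSq]
  exact setIntegral_mono_set (BaezDuarteU.integrableOn_norm_sq_nbFun _ c (one_le_bdDil N))
    (ae_of_all _ fun t ↦ sq_nonneg _)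
    (show Set.Ioi (1 : ℝ) ≤ Set.Ioi 0 from Set.Ioi_subset_Ioi zero_le_one).eventuallyLE

/-- **The plateau values**: `|P_m| ≤ 2(m+1)·d_N(c)` for every `m ≥ 1`,
`P_m = 1 + Σ_j c_j ⌊m/(j+1)⌋` (from `∫_{1/(m+1)}^{1/m} (P_m − T/t)² ≤ d²`, `T² ≤ d²`). -/
theorem abs_plateau_le (N : ℕ) (c : Fin N → ℝ) {m : ℕ} (hm : 1 ≤ m) :
    |1 + ∑ j : Fin N, c j * (((m / ((j : ℕ) + 1) : ℕ) : ℝ))| ≤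
      2 * ((m : ℝ) + 1) * Real.sqrt (nbDistSq N c) := by
  set P := 1 + ∑ j : Fin N, c j * (((m / ((j : ℕ) + 1) : ℕ) : ℝ)) with hP
  set T := ∑ j : Fin N, c j / (((j : ℕ) : ℝ) + 1) with hT
  set D := nbDistSq N c with hD
  have hD0 : 0 ≤ D := nbDistSq_nonneg' N c
  have hT2 : T ^ 2 ≤ D := sq_tailCoeff_le_nbDistSq N c
  have hmpos : (0 : ℝ) < m := by exact_mod_cast hm
  have hm1 : (0 : ℝ) < (m : ℝ) + 1 := by positivity
  have hab : 1 / ((m : ℝ) + 1) ≤ 1 / (m : ℝ) := one_div_le_one_div_of_le hmpos (by linarith)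
  have hvol : volume.real (Ioo (1 / ((m : ℝ) + 1)) (1 / (m : ℝ))) =
      1 / ((m : ℝ) * ((m : ℝ) + 1)) := by
    rw [Real.volume_real_Ioo_of_le hab]
    field_simp
    ring
  have hpt : ∀ t ∈ Ioo (1 / ((m : ℝ) + 1)) (1 / (m : ℝ)),
      P ^ 2 / 2 - T ^ 2 * ((m : ℝ) + 1) ^ 2 ≤ ‖BaezDuarteU.nbFun (bdDil N) c t‖ ^ 2 := by
    intro t ht
    rw [nbFun_plateau N c hm ht, Complex.norm_real, Real.norm_eq_abs, sq_abs]
    have ht0 : 0 < t := lt_trans (by positivity) ht.1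
    have hinv : 1 / t < (m : ℝ) + 1 := by
      have h := ht.1
      rw [div_lt_iff₀ hm1] at h
      rw [div_lt_iff₀ ht0]
      linarith
    have hinv0 : 0 < 1 / t := by positivity
    have hTt : (T / t) ^ 2 ≤ T ^ 2 * ((m : ℝ) + 1) ^ 2 := by
      rw [div_eq_mul_one_div, mul_pow]
      exact mul_le_mul_of_nonneg_left (pow_le_pow_left₀ hinv0.le hinv.le 2) (sq_nonneg _)
    nlinarith [sq_nonneg (P - 2 * (T / t)), hTt]
  have hint : IntegrableOn (fun t ↦ ‖BaezDuarteU.nbFun (bdDil N) c t‖ ^ 2)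
      (Ioo (1 / ((m : ℝ) + 1)) (1 / (m : ℝ))) volume :=
    (BaezDuarteU.integrableOn_norm_sq_nbFun _ c (one_le_bdDil N)).mono_set
      fun t ht ↦ lt_trans (by positivity) ht.1
  have hlow := setIntegral_ge_of_const_le_real measurableSet_Ioo measure_Ioo_lt_top.ne hpt hint
  have hup : ∫ t in Ioo (1 / ((m : ℝ) + 1)) (1 / (m : ℝ)), ‖BaezDuarteU.nbFun (bdDil N) c t‖ ^ 2
      ≤ D := by
    rw [hD, ← integral_norm_sq_nbFun_eq_nbDistSq]
    exact setIntegral_mono_set (BaezDuarteU.integrableOn_norm_sq_nbFun _ c (one_le_bdDil N))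
      (ae_of_all _ fun t ↦ sq_nonneg _)
      (show Set.Ioo (1 / ((m : ℝ) + 1)) (1 / (m : ℝ)) ≤ Set.Ioi 0 from
        fun t ht ↦ lt_trans (by positivity) ht.1).eventuallyLE
  rw [hvol] at hlow
  have key : P ^ 2 / 2 - T ^ 2 * ((m : ℝ) + 1) ^ 2 ≤ D * ((m : ℝ) * ((m : ℝ) + 1)) := by
    have h := hlow.trans hup
    rwa [mul_one_div, div_le_iff₀ (by positivity)] at h
  have hP2 : P ^ 2 ≤ (2 * ((m : ℝ) + 1) * Real.sqrt D) ^ 2 := by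
    rw [mul_pow, Real.sq_sqrt hD0]
    nlinarith [mul_le_mul_of_nonneg_right hT2 (sq_nonneg ((m : ℝ) + 1)), key,
      mul_nonneg hD0 hm1.le, mul_nonneg hD0 hmpos.le]
  exact abs_le_of_sq_le_sq hP2 (by positivity)

/-- The plateau value at `m = 0` is `1` (`⌊0/(j+1)⌋ = 0`). -/
theorem plateau_zero (N : ℕ) (c : Fin N → ℝ) :
    1 + ∑ j : Fin N, c j * (((0 / ((j : ℕ) + 1) : ℕ) : ℝ)) = 1 := by
  simp

/-! ## 3. The arithmetic side: plateau jumps are divisor sums; Möbius inversion with weighted errors -/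

/-- **Plateau jumps**: `P_{m+1} − P_m = Σ_{(j+1) ∣ (m+1)} c_j` (`⌊(m+1)/k⌋ = ⌊m/k⌋ + [k ∣ m+1]`). -/
theorem plateau_succ_sub (N : ℕ) (c : Fin N → ℝ) (m : ℕ) :
    (1 + ∑ j : Fin N, c j * ((((m + 1) / ((j : ℕ) + 1) : ℕ) : ℝ))) -
      (1 + ∑ j : Fin N, c j * (((m / ((j : ℕ) + 1) : ℕ) : ℝ))) =
      ∑ j : Fin N, if (j : ℕ) + 1 ∣ m + 1 then c j else 0 := by
  rw [add_sub_add_left_eq_sub, ← Finset.sum_sub_distrib]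
  refine Finset.sum_congr rfl fun j _ ↦ ?_
  rw [Nat.succ_div]
  split_ifs with h
  · push_cast
    ring
  · push_cast
    ring

open ArithmeticFunction in
/-- **Divisor sums of the coefficient function** `Φ(n) = Σ_j [j+1 = n] c_j`:
`(ζ * Φ)(m) = Σ_{(j+1) ∣ m} c_j` for `m ≥ 1`. -/
theorem coe_zeta_mul_coeffFn (N : ℕ) (c : Fin N → ℝ) {m : ℕ} (hm : m ≠ 0) :
    ((ζ : ArithmeticFunction ℝ) *
        toArithmeticFunction (fun n ↦ ∑ j : Fin N, if (j : ℕ) + 1 = n then c j else 0)) m =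
      ∑ j : Fin N, if (j : ℕ) + 1 ∣ m then c j else 0 := by
  rw [coe_zeta_mul_apply]
  have h1 : ∀ i ∈ m.divisors,
      toArithmeticFunction (fun n ↦ ∑ j : Fin N, if (j : ℕ) + 1 = n then c j else 0) i =
        ∑ j : Fin N, if (j : ℕ) + 1 = i then c j else 0 := by
    intro i hi
    rw [show toArithmeticFunction (fun n ↦ ∑ j : Fin N, if (j : ℕ) + 1 = n then c j else 0) i =
      if i = 0 then 0 else ∑ j : Fin N, if (j : ℕ) + 1 = i then c j else 0 from rfl,
      if_neg (Nat.pos_of_mem_divisors hi).ne']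
  rw [Finset.sum_congr rfl h1, Finset.sum_comm]
  refine Finset.sum_congr rfl fun j _ ↦ ?_
  rw [Finset.sum_ite_eq]
  simp only [Nat.mem_divisors, hm, ne_eq, not_false_eq_true, and_true]

/-- The coefficient function at `n = j+1` is `c_j`. -/
theorem coeffFn_apply_succ (N : ℕ) (c : Fin N → ℝ) (j : Fin N) :
    (∑ j' : Fin N, if (j' : ℕ) + 1 = (j : ℕ) + 1 then c j' else 0) = c j := by
  rw [Finset.sum_eq_single j]
  · rw [if_pos rfl]
  · intro j' _ hj'
    rw [if_neg]
    exact fun h ↦ hj' (Fin.ext (by omega))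
  · intro h
    exact absurd (Finset.mem_univ j) h

/-- The coefficient function vanishes beyond the length: `Φ(n) = 0` for `n > N`. -/
theorem coeffFn_apply_of_length_lt (N : ℕ) (c : Fin N → ℝ) {n : ℕ} (hn : N < n) :
    (∑ j : Fin N, if (j : ℕ) + 1 = n then c j else 0) = 0 := by
  refine Finset.sum_eq_zero fun j _ ↦ ?_
  rw [if_neg]
  have := j.2
  omega

open ArithmeticFunction in
/-- **Jump bound**: `|(ζ * Φ)(e) + δ(e)| ≤ (4e + 2)·d_N(c)` for every `e ≥ 1` (at `e = 1` the jump is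
`P_1 − P_0 = P_1 − 1`; for `e ≥ 2` it is `P_e − P_{e−1}`, and `|P_m| ≤ 2(m+1)d`). -/
theorem abs_divisorSum_add_one_le (N : ℕ) (c : Fin N → ℝ) {e : ℕ} (he : e ≠ 0) :
    |((ζ : ArithmeticFunction ℝ) *
        toArithmeticFunction (fun n ↦ ∑ j : Fin N, if (j : ℕ) + 1 = n then c j else 0)) e +
        (1 : ArithmeticFunction ℝ) e| ≤
      (4 * (e : ℝ) + 2) * Real.sqrt (nbDistSq N c) := by
  obtain ⟨m, rfl⟩ : ∃ m, e = m + 1 := ⟨e - 1, by omega⟩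
  have hd0 : 0 ≤ Real.sqrt (nbDistSq N c) := Real.sqrt_nonneg _
  have hP1 := abs_plateau_le N c (m := m + 1) (by omega)
  rw [coe_zeta_mul_coeffFn N c he, ← plateau_succ_sub N c m, one_apply]
  rcases Nat.eq_zero_or_pos m with h0 | hpos
  · subst h0
    rw [plateau_zero, if_pos rfl, sub_add_cancel]
    refine hP1.trans ?_
    push_cast
    nlinarith [hd0]
  · have hP0 := abs_plateau_le N c (m := m) hpos
    rw [if_neg (by omega), add_zero]
    refine (abs_sub _ _).trans ((add_le_add hP1 hP0).trans ?_)
    push_cast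
    nlinarith [hd0]

open ArithmeticFunction in
/-- **Möbius inversion with weighted errors.**  If `|(ζ * Φ)(e) + δ(e)| ≤ (4e+2)·d` for every divisor
`e` of `n ≥ 1`, then `|Φ(n) + μ(n)| ≤ 6 σ₁(n)·d` (`Φ + μ = μ * (ζ * Φ + δ)`, `|μ| ≤ 1`, `4e + 2 ≤ 6e`). -/
theorem abs_add_moebius_le_of_divisorSums {Φ : ArithmeticFunction ℝ} {d : ℝ} (hd : 0 ≤ d) {n : ℕ}
    (h : ∀ e ∈ n.divisors,
      |((ζ : ArithmeticFunction ℝ) * Φ) e + (1 : ArithmeticFunction ℝ) e| ≤ (4 * (e : ℝ) + 2) * d) :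
    |Φ n + (μ n : ℝ)| ≤ 6 * ((sigma 1 n : ℕ) : ℝ) * d := by
  set Ψ : ArithmeticFunction ℝ := (ζ : ArithmeticFunction ℝ) * Φ with hΨ
  have hinv : (μ : ArithmeticFunction ℝ) * Ψ = Φ := by
    rw [hΨ, ← mul_assoc, coe_moebius_mul_coe_zeta, one_mul]
  have hΦn : Φ n = ((μ : ArithmeticFunction ℝ) * Ψ) n := by rw [hinv]
  have hμn : (μ n : ℝ) = ((μ : ArithmeticFunction ℝ) * 1) n := by
    rw [mul_one, intCoe_apply]
  have hdiff : Φ n + (μ n : ℝ) =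
      ∑ p ∈ n.divisorsAntidiagonal, (μ p.1 : ℝ) * (Ψ p.2 + (1 : ArithmeticFunction ℝ) p.2) := by
    rw [hΦn, hμn, mul_apply, mul_apply, ← Finset.sum_add_distrib]
    refine Finset.sum_congr rfl fun p _ ↦ ?_
    rw [intCoe_apply, mul_add]
  rw [hdiff]
  calc |∑ p ∈ n.divisorsAntidiagonal, (μ p.1 : ℝ) * (Ψ p.2 + (1 : ArithmeticFunction ℝ) p.2)|
      ≤ ∑ p ∈ n.divisorsAntidiagonal, |(μ p.1 : ℝ) * (Ψ p.2 + (1 : ArithmeticFunction ℝ) p.2)| :=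
        Finset.abs_sum_le_sum_abs _ _
    _ ≤ ∑ p ∈ n.divisorsAntidiagonal, 6 * (p.2 : ℝ) * d := by
        refine Finset.sum_le_sum fun p hp ↦ ?_
        rw [abs_mul]
        have h1 : |(μ p.1 : ℝ)| ≤ 1 := by exact_mod_cast abs_moebius_le_one
        have hp2 : p.2 ∈ n.divisors := Nat.snd_mem_divisors_of_mem_antidiagonal hp
        have h2 := h p.2 hp2
        have hp1 : (1 : ℝ) ≤ p.2 := by exact_mod_cast Nat.pos_of_mem_divisors hp2
        calc |(μ p.1 : ℝ)| * |Ψ p.2 + (1 : ArithmeticFunction ℝ) p.2|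
            ≤ 1 * ((4 * (p.2 : ℝ) + 2) * d) :=
              mul_le_mul h1 h2 (abs_nonneg _) zero_le_one
          _ ≤ 6 * (p.2 : ℝ) * d := by nlinarith [mul_nonneg (sub_nonneg.mpr hp1) hd]
    _ = 6 * ((sigma 1 n : ℕ) : ℝ) * d := by
        rw [Nat.sum_divisorsAntidiagonal' (fun _ e ↦ 6 * (e : ℝ) * d), sigma_one_apply,
          Nat.cast_sum, Finset.mul_sum, Finset.sum_mul]

end Summit.RiemannHypothesis.RiemannHypothesis.Theorems.Splittings.NbPlateauLock
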